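import Literature.NumberTheory.Transcendental.CurvePeriodsEllipticEndgameProofs
import Literature.NumberTheory.Transcendental.TwoCurvePeriods
import HarnessLib

/-!
# Periods of curve type: closed paths on two non-isogenous elliptic curves, from the dimension formula

Companion of `Literature/NumberTheory/Transcendental/CurvePeriods.lean` (Huber–Wüstholz 2022,
Thm. 13.3 (2) = Kontsevich's period conjecture for periods of curve type, rendered on explicit
period symbols `(Z, ω, γ)` with the elementary relations (R1)–(R5); general statement: the named
fact `HuberWustholzCurvePeriods`). Beyond one isogeny class of elliptic curves
(`CurvePeriodsEllipticIsogenousPathsProofs.lean`, unconditional) the transcendence input of the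
printed proof is Wüstholz's analytic subgroup theorem for PRODUCTS of non-isogenous curves, which
the tree records — for two curves and closed paths — as the named fact
`HuberWustholzTwoCurvePeriods` (Huber–Wüstholz, Thm. 15.3 (1), instance `[ℤ →⁰ 𝔾ₘ] × E × E′`: the
ten 1-periods `1, 2πi, ω₁, ω₂, η₁, η₂, ω₁′, ω₂′, η₁′, η₂′` of two non-CM, non-isogenous elliptic
curves over `ℚ̄` are `ℚ̄`-linearly independent; UNPROVED in the tree, taken as a hypothesis here).
This file wires that fact to the curve-period statement:

* `huberWustholzCurvePeriods_of_twoCurveLoops` — **Theorem 13.3 (2) for closed paths on two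
  non-CM, non-isogenous elliptic curves `E_L`, `E_{L′}` together with closed paths on `𝔾ₘ` and
  `𝔸¹`, from `HuberWustholzTwoCurvePeriods`**: the closed-path normal forms
  (`Ell.exists_loop_normalForm` on each curve, `exists_rel_of_mulGroup_closed`,
  `exists_rel_of_affineLine`) have period
  `2(A₀ω₁ + A₁ω₂) − 2(B₀η₁ + B₁η₂) + 2(A₀′ω₁′ + A₁′ω₂′) − 2(B₀′η₁′ + B₁′η₂′) + 2πi·Q + E`, and the
  ten-period independence forces all coefficients to vanish.

So the two-curve closed-path case of the fact is EXACTLY as hard as the named fact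
`HuberWustholzTwoCurvePeriods`; the converse bookkeeping (ten generators, no further relations) is
the content of the dimension count `δ = 10`.

## References

* A. Huber, G. Wüstholz, *Transcendence and Linear Relations of 1-Periods*, Cambridge Tracts in
  Mathematics 227, CUP 2022 [HuberWustholz2022]: Thm. 13.3 (2) (p. 121 of the held text), §13.2
  (pp. 122–125), Thm. 15.3 (1) (p. 145), §18.1 (p. 160).
-/

noncomputable section

open scoped BigOperators
open scoped PeriodPair
open MvPolynomial Set Complex

namespace Literature.NumberTheory.Transcendental

namespace CurvePeriods

set_option quotPrecheck false in
/-- Membership in the `ℚ̄`-span of the elementary relations, in the format of the conclusion of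
`HuberWustholzCurvePeriods`. -/
local notation "InSpan" c:max => ∃ (k : ℕ) (ρ : Fin k → (PeriodSymbol →₀ ℂ)) (a : Fin k → ℂ),
  (∀ l, IsElementaryRelation (ρ l)) ∧ (∀ l, IsAlgebraic ℚ (a l)) ∧ c = ∑ l, a l • ρ l

/-- **Huber–Wüstholz, Theorem 13.3 (2), for closed paths on two non-CM, non-isogenous elliptic
curves together with closed paths on `𝔾ₘ` and `𝔸¹` — from the two-curve dimension formula
`HuberWustholzTwoCurvePeriods` (an unproved named fact of the tree, taken as a hypothesis).**
[cite: HuberWustholz2022, Thm. 13.3 (2) (p. 121), §13.2 (pp. 122–125), Thm. 15.3 (1) (p. 145)] -/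
theorem huberWustholzCurvePeriods_of_twoCurveLoops (hTC : HuberWustholzTwoCurvePeriods)
    (L L' : PeriodPair) (h₂ : IsAlgebraic ℚ L.g₂) (h₃ : IsAlgebraic ℚ L.g₃)
    (h₂' : IsAlgebraic ℚ L'.g₂) (h₃' : IsAlgebraic ℚ L'.g₃) (hCM : ¬ L.HasCM) (hCM' : ¬ L'.HasCM)
    (hiso : ¬ L.IsIsogenousTo L')
    (c : PeriodSymbol →₀ ℂ) (hc : ∀ s, IsAlgebraic ℚ (c s))
    (hsupp : ∀ s ∈ c.support,
      (s.Z = Ell.curve L ∧ s.γ.toFun 1 = s.γ.toFun 0) ∨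
        (s.Z = Ell.curve L' ∧ s.γ.toFun 1 = s.γ.toFun 0) ∨
        (s.Z = (⟨2, 1, ![X 0 * X 1 - 1]⟩ : CurveData) ∧ s.γ.toFun 1 = s.γ.toFun 0) ∨
        s.Z = CurveData.affineLine)
    (h0 : evalCombination c = 0) :
    ∃ (k : ℕ) (ρ : Fin k → (PeriodSymbol →₀ ℂ)) (a : Fin k → ℂ),
      (∀ l, IsElementaryRelation (ρ l)) ∧ (∀ l, IsAlgebraic ℚ (a l)) ∧ c = ∑ l, a l • ρ l := by
  classical
  -- the standard loop on `𝔾ₘ`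
  obtain ⟨Λ₁, hΛ₁⟩ := exists_stdLoop isAlgebraic_one one_ne_zero (1 : ℤ)
  set ℓ₁ : PeriodSymbol := ⟨⟨2, 1, ![X 0 * X 1 - 1]⟩, isSmoothAffineCurve_mulGroup, ![X 1, 0],
    hasAlgCoeffs_ydx, Λ₁⟩ with hℓ₁
  have hℓ₁per : ℓ₁.period = 2 * Real.pi * I := by
    rw [hℓ₁, period_ydx_stdLoop one_ne_zero 1 Λ₁ hΛ₁]
    simp
  -- Phase A: normal form of every symbol
  have key : ∀ s : PeriodSymbol, ∃ (A B A' B' : Fin 2 → ℂ) (q e : ℂ), s ∈ c.support →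
      ((∀ j, IsAlgebraic ℚ (A j)) ∧ (∀ j, IsAlgebraic ℚ (B j)) ∧ (∀ j, IsAlgebraic ℚ (A' j)) ∧
        (∀ j, IsAlgebraic ℚ (B' j)) ∧ IsAlgebraic ℚ q ∧ IsAlgebraic ℚ e ∧
        InSpan (Finsupp.single s (1 : ℂ) - Ell.loopPart L h₂ h₃ A B - Ell.loopPart L' h₂' h₃' A' B' -
          q • Finsupp.single ℓ₁ (1 : ℂ) - e • Finsupp.single PeriodSymbol.unit (1 : ℂ))) := by
    intro s
    by_cases hs : s ∈ c.support
    · have halg0 : ∀ j : Fin 2, IsAlgebraic ℚ ((0 : Fin 2 → ℂ) j) := fun _ => isAlgebraic_zero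
      rcases hsupp s hs with ⟨hsZ, hcl⟩ | ⟨hsZ, hcl⟩ | ⟨hsZ, hcl⟩ | hsA
      · obtain ⟨Z, hZ, ω, hω, γ⟩ := s
        dsimp only at hsZ hcl
        subst hsZ
        obtain rfl : hZ = Ell.smooth L h₂ h₃ := rfl
        obtain ⟨A, B, e, hA, hB, he, hrel⟩ := Ell.exists_loop_normalForm L h₂ h₃ γ hcl ω hω
        refine ⟨A, B, 0, 0, 0, e, fun _ => ⟨hA, hB, halg0, halg0, isAlgebraic_zero, he, ?_⟩⟩
        obtain ⟨k, ρ, cf, hρ, hcf, hsum⟩ := hrel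
        exact ⟨k, ρ, cf, hρ, hcf, by rw [← hsum, Ell.loopPart_zero, zero_smul, sub_zero, sub_zero]⟩
      · obtain ⟨Z, hZ, ω, hω, γ⟩ := s
        dsimp only at hsZ hcl
        subst hsZ
        obtain rfl : hZ = Ell.smooth L' h₂' h₃' := rfl
        obtain ⟨A, B, e, hA, hB, he, hrel⟩ := Ell.exists_loop_normalForm L' h₂' h₃' γ hcl ω hω
        refine ⟨0, 0, A, B, 0, e, fun _ => ⟨halg0, halg0, hA, hB, isAlgebraic_zero, he, ?_⟩⟩
        obtain ⟨k, ρ, cf, hρ, hcf, hsum⟩ := hrel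
        exact ⟨k, ρ, cf, hρ, hcf, by rw [← hsum, Ell.loopPart_zero, zero_smul, sub_zero, sub_zero]⟩
      · obtain ⟨q, hq, k, ρ, cf, hρ, hcf, hsum⟩ := exists_rel_of_mulGroup_closed s hsZ hcl Λ₁ hΛ₁
        refine ⟨0, 0, 0, 0, q, 0, fun _ =>
          ⟨halg0, halg0, halg0, halg0, hq, isAlgebraic_zero, ?_⟩⟩
        exact ⟨k, ρ, cf, hρ, hcf, by
          rw [← hsum, Ell.loopPart_zero, Ell.loopPart_zero, zero_smul, sub_zero, sub_zero, sub_zero]⟩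
      · obtain ⟨π₀, hπ₀, -, hrel⟩ := exists_rel_of_affineLine s hsA
        refine ⟨0, 0, 0, 0, 0, π₀, fun _ =>
          ⟨halg0, halg0, halg0, halg0, isAlgebraic_zero, hπ₀, ?_⟩⟩
        obtain ⟨k, ρ, cf, hρ, hcf, hsum⟩ := span_of_rel hrel
        exact ⟨k, ρ, cf, hρ, hcf, by
          rw [← hsum, Ell.loopPart_zero, Ell.loopPart_zero, zero_smul, sub_zero, sub_zero, sub_zero]⟩
    · exact ⟨0, 0, 0, 0, 0, 0, fun h => (hs h).elim⟩
  choose A B A' B' q e hkey using key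
  -- Phase B: sum over the support
  have hspan' : ∀ T : Finset PeriodSymbol, T ⊆ c.support →
      InSpan (∑ s ∈ T, c s • (Finsupp.single s (1 : ℂ) - Ell.loopPart L h₂ h₃ (A s) (B s) -
        Ell.loopPart L' h₂' h₃' (A' s) (B' s) - q s • Finsupp.single ℓ₁ (1 : ℂ) -
        e s • Finsupp.single PeriodSymbol.unit (1 : ℂ))) := by
    intro T hT
    induction T using Finset.induction_on with
    | empty => simpa using span_zero
    | insert s T hs ih =>
      rw [Finset.sum_insert hs]
      exact span_add (span_smul (hc s) (hkey s (hT (Finset.mem_insert_self s T))).2.2.2.2.2.2)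
        (ih (subset_trans (Finset.subset_insert s T) hT))
  obtain ⟨k, ρ, cf, hρ, hcf, hmain⟩ := hspan' c.support subset_rfl
  set Atot : Fin 2 → ℂ := ∑ s ∈ c.support, c s • A s with hAtot
  set Btot : Fin 2 → ℂ := ∑ s ∈ c.support, c s • B s with hBtot
  set A'tot : Fin 2 → ℂ := ∑ s ∈ c.support, c s • A' s with hA'tot
  set B'tot : Fin 2 → ℂ := ∑ s ∈ c.support, c s • B' s with hB'tot
  set Qtot : ℂ := ∑ s ∈ c.support, c s * q s with hQtot
  set Etot : ℂ := ∑ s ∈ c.support, c s * e s with hEtot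
  have hc_eq : c = ∑ s ∈ c.support, c s • Finsupp.single s (1 : ℂ) := by
    conv_lhs => rw [← Finsupp.sum_single c]
    simp only [Finsupp.sum, Finsupp.smul_single_one]
  have hident : ∑ s ∈ c.support, c s • (Finsupp.single s (1 : ℂ) - Ell.loopPart L h₂ h₃ (A s) (B s) -
        Ell.loopPart L' h₂' h₃' (A' s) (B' s) - q s • Finsupp.single ℓ₁ (1 : ℂ) -
        e s • Finsupp.single PeriodSymbol.unit (1 : ℂ)) =
      c - (Ell.loopPart L h₂ h₃ Atot Btot + Ell.loopPart L' h₂' h₃' A'tot B'tot +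
        Qtot • Finsupp.single ℓ₁ (1 : ℂ) + Etot • Finsupp.single PeriodSymbol.unit (1 : ℂ)) := by
    simp only [smul_sub, Ell.smul_loopPart, smul_smul, Finset.sum_sub_distrib, ← hc_eq,
      Ell.loopPart_finset_sum, hAtot, hBtot, hA'tot, hB'tot, hQtot, hEtot, Finset.sum_smul]
    abel
  rw [hident] at hmain
  -- the period of the normal form vanishes
  have hev : 2 * (Atot 0 * L.ω₁ + Atot 1 * L.ω₂) - 2 * (Btot 0 * L.η₁ + Btot 1 * L.η₂) +
      (2 * (A'tot 0 * L'.ω₁ + A'tot 1 * L'.ω₂) - 2 * (B'tot 0 * L'.η₁ + B'tot 1 * L'.η₂)) +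
      Qtot * (2 * Real.pi * I) + Etot = 0 := by
    have h1 := evalCombination_eq_zero_of_isElementaryRelation ρ cf hρ
    rw [← hmain, sub_eq_add_neg, evalCombination_add, h0, zero_add, ← neg_one_smul ℂ,
      evalCombination_smul, evalCombination_add, evalCombination_add, evalCombination_add,
      evalCombination_smul, evalCombination_smul, evalCombination_single, evalCombination_single,
      period_unit, hℓ₁per, Ell.evalCombination_loopPart, Ell.evalCombination_loopPart] at h1
    rw [neg_one_mul, neg_eq_zero] at h1
    linear_combination h1
  -- algebraicity of the coefficients
  have hnA : ∀ j, IsAlgebraic ℚ (Atot j) := fun j => by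
    rw [hAtot, Finset.sum_apply]
    exact isAlgebraic_finsetSum _ _ fun s hs => (hc s).mul ((hkey s hs).1 j)
  have hnB : ∀ j, IsAlgebraic ℚ (Btot j) := fun j => by
    rw [hBtot, Finset.sum_apply]
    exact isAlgebraic_finsetSum _ _ fun s hs => (hc s).mul ((hkey s hs).2.1 j)
  have hnA' : ∀ j, IsAlgebraic ℚ (A'tot j) := fun j => by
    rw [hA'tot, Finset.sum_apply]
    exact isAlgebraic_finsetSum _ _ fun s hs => (hc s).mul ((hkey s hs).2.2.1 j)
  have hnB' : ∀ j, IsAlgebraic ℚ (B'tot j) := fun j => by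
    rw [hB'tot, Finset.sum_apply]
    exact isAlgebraic_finsetSum _ _ fun s hs => (hc s).mul ((hkey s hs).2.2.2.1 j)
  have hQalg : IsAlgebraic ℚ Qtot :=
    isAlgebraic_finsetSum _ _ fun s hs => (hc s).mul (hkey s hs).2.2.2.2.1
  have hEalg : IsAlgebraic ℚ Etot :=
    isAlgebraic_finsetSum _ _ fun s hs => (hc s).mul (hkey s hs).2.2.2.2.2.1
  -- the ten-period independence
  set β : Fin 10 → ℂ := ![Etot, Qtot, 2 * Atot 0, 2 * Atot 1, -2 * Btot 0, -2 * Btot 1,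
    2 * A'tot 0, 2 * A'tot 1, -2 * B'tot 0, -2 * B'tot 1] with hβ
  have h2alg : IsAlgebraic ℚ (2 : ℂ) := isAlgebraic_nat 2
  have hβalg : ∀ i, IsAlgebraic ℚ (β i) := by
    intro i
    fin_cases i
    · exact hEalg
    · exact hQalg
    · exact h2alg.mul (hnA 0)
    · exact h2alg.mul (hnA 1)
    · exact h2alg.neg.mul (hnB 0)
    · exact h2alg.neg.mul (hnB 1)
    · exact h2alg.mul (hnA' 0)
    · exact h2alg.mul (hnA' 1)
    · exact h2alg.neg.mul (hnB' 0)
    · exact h2alg.neg.mul (hnB' 1)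
  have hβsum : ∑ i, β i *
      ![1, 2 * Real.pi * I, L.ω₁, L.ω₂, L.η₁, L.η₂, L'.ω₁, L'.ω₂, L'.η₁, L'.η₂] i = 0 := by
    simp only [Fin.sum_univ_succ, Fin.sum_univ_zero, hβ]
    simp
    linear_combination hev
  have hzero := hTC L L' h₂ h₃ h₂' h₃' hCM hCM' hiso β hβalg hβsum
  have hE0 : Etot = 0 := by simpa [hβ] using hzero 0
  have hQ0 : Qtot = 0 := by simpa [hβ] using hzero 1
  have hA0 : Atot = 0 := by
    funext j
    fin_cases j
    · have h := hzero 2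
      simpa [hβ] using h
    · have h := hzero 3
      simpa [hβ] using h
  have hB0 : Btot = 0 := by
    funext j
    fin_cases j
    · have h := hzero 4
      simpa [hβ] using h
    · have h := hzero 5
      simpa [hβ] using h
  have hA'0 : A'tot = 0 := by
    funext j
    fin_cases j
    · have h := hzero 6
      simpa [hβ] using h
    · have h := hzero 7
      simpa [hβ] using h
  have hB'0 : B'tot = 0 := by
    funext j
    fin_cases j
    · have h := hzero 8
      simpa [hβ] using h
    · have h := hzero 9
      simpa [hβ] using h
  refine ⟨k, ρ, cf, hρ, hcf, ?_⟩
  rw [← hmain, hA0, hB0, hA'0, hB'0, hQ0, hE0, Ell.loopPart_zero, Ell.loopPart_zero]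
  simp

end CurvePeriods

end Literature.NumberTheory.Transcendental

end
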